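import Summits.QuantumFields.BalabanUV.T4Continuum.Support.SmallFieldDomainsMetricSchur
import Summits.QuantumFields.BalabanUV.T4Continuum.Support.SmallFieldDomainsMetricSep
import Literature.MathematicalPhysics.QuantumFieldTheory.Balaban1983to89.B6LevelGapMetric

/-!
# T⁴ programme, SUBSTRATE — `Support/SmallFieldDomainsContour`: the ADMISSIBLE-BOND GRAPH of a big-block domain sequence on `ℤ^d`
# (the `ℤ^d` reading of [Balaban1984PropagatorsII] (2.46)'s admissible contours), its junction with the ABSTRACT zoned-graph modules
# `Literature/…/B6LevelGapMetric` ∕ `B6Geometry` (the printed-shape hypotheses (len) `BondScale` and (sep) `ZoneSep` DISCHARGED from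
# `BigDomainSeq.sep` ⇒ `LevelGap` BY NAME), and the ONE-SIDED comparison `d_Ω ≤ c⁻¹ · (number of admissible bonds)` with the substrate's
# fine-path distance `msDistΩ` (map item P4-8; XREAD INTERFACE-1 of journal l.15089 ∕ l.15104, typer MAP v0.6 §O1 (2.46)′)

Audit cell `pub-balaban`, SUBSTRATE cell seat p4; same namespace as `Support/SmallFieldDomains{,Norms,Metric,MetricSchur,MetricSep}` (`BigDomainSeq`,
`ptIndex`, `layer`, `Adj`/`IsPath`/`pathCost`/`msDist`/`layerWeight`/`msDistΩ`, `WSupLePrint.of_localDecay`, `indexSep_msDistΩ_ptIndex`); `IsLevel` of `Literature/…/B8ConstraintBonds`, `e μ` of `…/B7Prop1Explicit`, and the zoned-graph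
vocabulary `B6Geometry.LevelGap` ∕ `B6LevelGapMetric.BondScale` ∕ `ZoneSep` ∕ `levelGap_of_metric` ∕ `B6Geometry.levelGap_dist` BY NAME (nothing restated).

WHAT IS PRINTED (documentation; nothing asserted).  [Balaban1984PropagatorsII] p. 231 (render `…-p009-x2.png`): *"We consider a special class of
contours Γ. They have the property that a part of Γ contained in B^j(Λ_j) consists of bonds of the lattice Λ_j."*; p. 224 (2.2) *"(L^jη)^{−1}
dist(Ω_j^c, Ω_{j+1}) > RM"*; Lemma 2.1 (2.60) p. 234 *"e^{−αδ₀d(y,y′)} ≦ e^{−αδ₀RM max{|j−j′|−1,0}}"*.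
THE `ℤ^d` READING OF ADMISSIBILITY (declared; the cell's, DIVERGENCE row (2.46)′): with half-open blocks `[c, c + L^j)` (the tree's `cubeIdx` floor
convention) a LEVEL-`j` BOND is `{a, a + L^j e_μ}` with `a` a level-`j` lattice point (`IsLevel L j a`); it is ADMISSIBLE iff the SMALLER of the two
endpoint indices is exactly `j` (`min (ι a) (ι b) = j`) — inside the layer `j` these are the `Λ_j`-bonds of print, a bond between the layers `j` and
`j + 1` is a `Λ_j`-bond (print's surface crossings), and outside `Ω₀` (index `0`, print's `Λ₀`) every unit bond is admissible.
WHAT THIS FILE PROVIDES (all `[folklore]`):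
 * §1 `admGraph L k Ω : SimpleGraph (Pt d)` and the shape of its edges (`admGraph_adj_iff`, sup-distance of an edge `= L^{min}`);
 * §2 THE JUNCTION WITH `B6LevelGapMetric`: for a big-block domain sequence, (len) `bondScale_admGraph : BondScale (admGraph …) (ptIndex k Ω) id (L^·)`
   and (sep) `zoneSep_admGraph : ZoneSep (ptIndex k Ω) id (L^·) (R·M₁)` in the sup-metric of `ℤ^d = Fin d → ℤ` (from `BigDomainSeq.sep`), hence
   **`levelGap_admGraph : LevelGap (admGraph L k Ω) (ptIndex k Ω) N`** for every `N ≤ R·M₁` (`levelGap_of_metric` BY NAME) and, for a connected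
   admissible graph, `B6Geometry.levelGap_dist` ⇒ **`levelGap_dist_admGraph`**: `N·(ι x′ − ι x − 1) ≤ dist_G x x′` — [B6] (2.60)'s shape for the
   ADMISSIBLE-BOND distance on the substrate's `ℤ^d` objects (the walk-form hypothesis of the Literature chain DISCHARGED here);
 * §3 THE ONE-SIDED COMPARISON with the fine-path distance: every admissible bond is refined into `L^j` unit steps inside `Ω_j`, each costing at most
   `(s j)⁻¹` for NON-DECREASING scales, so `d_Ω(a, b) ≤ L^j·(s j)⁻¹` per edge (`msDistΩ_le_of_admAdj`) and, for geometric scales `s i = c·L^i`,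
   **`msDistΩ_le_walk_length`**: `d_Ω(x, x′) ≤ c⁻¹ · (length of any admissible walk from x to x′)`, i.e. `d_Ω ≤ c⁻¹·dist_G` on reachable pairs
   (`msDistΩ_le_dist_admGraph`).  The REVERSE inequality is NOT claimed (fine paths may be cheaper than admissible contours — the declared relaxation);
 * §4 THE ASSEMBLED JUNCTION AT `d_Ω`: `WSupLePrint.of_localDecay_msDistΩ` = `SmallFieldDomainsMetricSchur.WSupLePrint.of_localDecay` with its
   (2.60)-shape separation hypothesis DISCHARGED by `SmallFieldDomainsMetricSep.indexSep_msDistΩ_ptIndex` — what stays a hypothesis is exactly the two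
   printed ESTIMATES ((3.42)-shape local decay, (2.61)-shape row sum).
HONEST FRAMING (T4-DAG p. 1).  Region∕metric GEOMETRY on `ℤ^d`; no configuration, no estimate of any NE row ([B6] (2.61) untouched); spine 0/9 unchanged;
NOT infinite volume, NOT a mass gap, NOT Clay.  HONEST DEPENDENCY: continuum YM on T⁴ ⇐ BetaPertH ∧ nine spine estimates (0/9 proved); BetaPertH ⇐ (D1) ∧
(D4) ∧ CAP+tail; G-an2-4 gates asym, D1 and NE2/3/4.  No `sorry`.
-/

noncomputable section

open scoped BigOperators

namespace Summit.QuantumFields.BalabanUV.T4Continuum.SmallFieldDomains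

open Literature.MathematicalPhysics.QuantumFieldTheory.Balaban1983to89.B14DomainGeom
open Literature.MathematicalPhysics.QuantumFieldTheory.Balaban1983to89.B8ConstraintBonds (IsLevel)
open Literature.MathematicalPhysics.QuantumFieldTheory.Balaban1983to89.B7Prop1Explicit (e l1)
open Literature.MathematicalPhysics.QuantumFieldTheory.Balaban1983to89.B6Geometry (LevelGap levelGap_dist)
open Literature.MathematicalPhysics.QuantumFieldTheory.Balaban1983to89.B6LevelGapMetric (BondScale ZoneSep levelGap_of_metric)

variable {d : ℕ}

/-! ## §1 The admissible-bond graph of a domain sequence -/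

/-- ADMISSIBLE ADJACENCY: `{a, b}` is a level-`j` bond — `b = a + L^j e_μ` with `a` a level-`j` lattice point, or the other way round — whose
smaller endpoint index is exactly `j`. [folklore] -/
def AdmAdj (L k : ℕ) (Ω : ℕ → Set (Pt d)) (a b : Pt d) : Prop :=
  a ≠ b ∧ ∃ (j : ℕ) (μ : Fin d), min (ptIndex k Ω a) (ptIndex k Ω b) = j ∧
    ((IsLevel L j a ∧ b = a + ((L : ℤ) ^ j) • e μ) ∨ (IsLevel L j b ∧ a = b + ((L : ℤ) ^ j) • e μ))

/-- Admissible adjacency is symmetric. [folklore] -/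
theorem AdmAdj.symm {L k : ℕ} {Ω : ℕ → Set (Pt d)} {a b : Pt d} (h : AdmAdj L k Ω a b) : AdmAdj L k Ω b a := by
  obtain ⟨hne, j, μ, hj, hor⟩ := h
  refine ⟨hne.symm, j, μ, by rw [min_comm]; exact hj, ?_⟩
  rcases hor with h | h
  · exact Or.inr h
  · exact Or.inl h

/-- **THE ADMISSIBLE-BOND GRAPH** of a domain sequence on `ℤ^d` (the `ℤ^d` reading of the admissible contours of (2.46)). [folklore] -/
def admGraph (L k : ℕ) (Ω : ℕ → Set (Pt d)) : SimpleGraph (Pt d) where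
  Adj := AdmAdj L k Ω
  symm := ⟨fun _ _ (h : AdmAdj L k Ω _ _) => h.symm⟩
  loopless := ⟨fun _ (h : AdmAdj L k Ω _ _) => h.1 rfl⟩

/-- Adjacency in the admissible-bond graph, unfolded. [folklore] -/
theorem admGraph_adj_iff {L k : ℕ} {Ω : ℕ → Set (Pt d)} {a b : Pt d} : (admGraph L k Ω).Adj a b ↔ AdmAdj L k Ω a b := by
  rfl

/-- The two endpoints of a level-`j` bond differ by `L^j` in one coordinate and agree in the others. [folklore] -/
theorem sub_eq_of_levelBond {L j : ℕ} {μ : Fin d} {a b : Pt d} (h : b = a + ((L : ℤ) ^ j) • e μ) (i : Fin d) :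
    b i - a i = if i = μ then (L : ℤ) ^ j else 0 := by
  rw [h, Pi.add_apply, Pi.smul_apply, add_sub_cancel_left]
  by_cases hi : i = μ
  · subst hi; simp [e]
  · simp [e, hi]

/-- The SUP-DISTANCE of an admissible bond is at most `L^j`, `j` = the smaller endpoint index (in fact equal; `≤` is what (len) needs) — the metric of
`ℤ^d = Fin d → ℤ` being the sup-metric. [folklore] -/
theorem dist_le_of_admAdj {L k : ℕ} {Ω : ℕ → Set (Pt d)} {a b : Pt d} (h : (admGraph L k Ω).Adj a b) :
    dist a b ≤ ((L : ℝ) ^ min (ptIndex k Ω a) (ptIndex k Ω b)) := by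
  obtain ⟨_, j, μ, hj, hor⟩ := admGraph_adj_iff.mp h
  rw [hj]
  have hL : (0 : ℝ) ≤ (L : ℝ) ^ j := by positivity
  refine (dist_pi_le_iff hL).mpr fun i => ?_
  have key : ∀ {u v : Pt d}, v = u + ((L : ℤ) ^ j) • e μ → dist (u i) (v i) ≤ (L : ℝ) ^ j := by
    intro u v huv
    rw [Int.dist_eq, abs_sub_comm, ← Int.cast_sub, sub_eq_of_levelBond huv i]
    split_ifs
    · push_cast; rw [abs_of_nonneg hL]
    · simp [hL]
  rcases hor with ⟨_, hb⟩ | ⟨_, ha⟩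
  · exact key hb
  · rw [dist_comm]; exact key ha

/-! ## §2 The junction with `B6LevelGapMetric`: (len), (sep), hence the level gap and (2.60)'s shape -/

section Junction
variable {L M₁ R k : ℕ} {Ω : ℕ → Set (Pt d)}

/-- **(len)** for the admissible-bond graph: an edge has sup-length `≤ L^{min zone}` — `BondScale` with `pos = id`, `ℓ j = L^j`. [folklore] -/
theorem bondScale_admGraph (L k : ℕ) (Ω : ℕ → Set (Pt d)) :
    BondScale (admGraph L k Ω) (ptIndex k Ω) (id : Pt d → Pt d) (fun j => (L : ℝ) ^ j) :=
  fun _ _ h => dist_le_of_admAdj h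

/-- A point of positive index lies in the domain of its index (and so in every shallower one). [folklore] -/
theorem mem_of_ptIndex_pos (hΩ : BigDomainSeq L M₁ R k Ω) {x : Pt d} (hx : 0 < ptIndex k Ω x) {i : ℕ} (hi : i ≤ ptIndex k Ω x) :
    x ∈ Ω i := by
  classical
  have hmem : x ∈ Ω (ptIndex k Ω x) :=
    Nat.findGreatest_of_ne_zero (P := fun j => x ∈ Ω j) rfl (Nat.pos_iff_ne_zero.mp hx)
  exact hΩ.anti_le hi hmem

/-- **(sep)** for the admissible-bond graph FROM `BigDomainSeq.sep`: a point of index `< i` and a point of index `> i` are more than `R·M₁·L^i` apart in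
the sup-metric — `ZoneSep` with `pos = id`, `ℓ j = L^j`, `T = R·M₁` (p. 224 (2.2) for the cell's reading). [folklore] -/
theorem zoneSep_admGraph (hΩ : BigDomainSeq L M₁ R k Ω) :
    ZoneSep (ptIndex k Ω) (id : Pt d → Pt d) (fun j => (L : ℝ) ^ j) ((R : ℝ) * M₁) := by
  intro i u x hu hx
  -- `x ∈ Ω_{i+1}` (index `> i`), `u ∉ Ω_i` (index `< i`)
  have hxmem : x ∈ Ω (i + 1) := mem_of_ptIndex_pos hΩ (by omega) (by omega)
  have humem : u ∉ Ω i := fun h => by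
    have := le_ptIndex_of_mem (hΩ.le_of_mem h) h
    omega
  -- hence `u` is not within `R M₁ L^i` of `x`
  have hnw : ¬ Within ((R : ℤ) * M₁ * L ^ i) x u := fun hw => humem (hΩ.sep i x hxmem u hw)
  simp only [Within, not_forall, not_le] at hnw
  obtain ⟨i₀, hi₀⟩ := hnw
  have h1 : ((R : ℝ) * M₁) * (L : ℝ) ^ i < |((x i₀ : ℤ) : ℝ) - ((u i₀ : ℤ) : ℝ)| := by
    have : (((R : ℤ) * M₁ * L ^ i : ℤ) : ℝ) < ((|x i₀ - u i₀| : ℤ) : ℝ) := by exact_mod_cast hi₀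
    rw [Int.cast_abs] at this
    push_cast at this
    linarith [this]
  calc ((R : ℝ) * M₁) * (L : ℝ) ^ i < |((x i₀ : ℤ) : ℝ) - ((u i₀ : ℤ) : ℝ)| := h1
    _ = dist (u i₀) (x i₀) := by rw [Int.dist_eq, abs_sub_comm]
    _ ≤ dist (id u) (id x) := dist_le_pi_dist u x i₀

/-- **THE LEVEL GAP OF THE ADMISSIBLE-BOND GRAPH** ([B6] (2.2)∕(2.57) in walk form, DISCHARGED for the cell's `ℤ^d` objects): for a big-block domain
sequence with `1 ≤ L`, every chain of admissible bonds from a point of index `< i` to a point of index `> i` has at least `N + 1` bonds, for every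
`N ≤ R·M₁` (`B6LevelGapMetric.levelGap_of_metric` BY NAME on (len) + (sep)). [folklore] -/
theorem levelGap_admGraph (hΩ : BigDomainSeq L M₁ R k Ω) (hL : 1 ≤ L) {N : ℕ} (hN : N ≤ R * M₁) :
    LevelGap (admGraph L k Ω) (ptIndex k Ω) N := by
  have hmono : Monotone (fun j : ℕ => (L : ℝ) ^ j) := fun a b hab => pow_le_pow_right₀ (by exact_mod_cast hL) hab
  exact levelGap_of_metric hmono (bondScale_admGraph L k Ω) (zoneSep_admGraph hΩ) (by exact_mod_cast hN)

/-- **[B6] (2.60)'s SHAPE FOR THE ADMISSIBLE-BOND DISTANCE on `ℤ^d`** (`B6Geometry.levelGap_dist` BY NAME): for a big-block domain sequence whose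
admissible-bond graph is connected, `N·(ι x′ − ι x − 1) ≤ dist_G(x, x′)` whenever `ι x < ι x′`, for every `N ≤ R·M₁`.
CAVEAT OF RECORD (XREAD finding F-SUB-p2-X1, substrate-p2 g3, journal l.16503; typer ruling (κ1) l.16816): the hypothesis `(admGraph L k Ω).Connected` is
UNSATISFIABLE as soon as some `Ω_j`, `j ≥ 1`, contains a point off the `L`-lattice ALL of whose `2d` unit neighbours have index `≥ 1` (such a point is an
isolated vertex; kernel witness `substrate/p2/xread/WitnessAdmGraphNotConnected.lean`) — which happens whenever `2 ≤ L` and `3 ≤ M₁·L` (an `M₁L^j`-cube then has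
an interior off-lattice point), i.e. in every case of interest (reader's gloss R-ne9leaf01g19-1); this theorem is true and vacuous there.  USE INSTEAD the
connectivity-free forms of `Support/SmallFieldDomainsContourGap`: `levelGap_walk_admGraph` (every admissible walk), `levelGap_edist_admGraph` (`ℕ∞`-distance,
unconditional; `⊤` = no admissible chain = print's `+∞`), `levelGap_dist_admGraph_of_reachable` (Mathlib `dist` on reachable pairs). [folklore] -/
theorem levelGap_dist_admGraph (hΩ : BigDomainSeq L M₁ R k Ω) (hL : 1 ≤ L) (hconn : (admGraph L k Ω).Connected) {N : ℕ}
    (hN : N ≤ R * M₁) {x x' : Pt d} (hlt : ptIndex k Ω x < ptIndex k Ω x') :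
    N * (ptIndex k Ω x' - ptIndex k Ω x - 1) ≤ (admGraph L k Ω).dist x x' :=
  levelGap_dist hconn (levelGap_admGraph hΩ hL hN) hlt

end Junction

/-! ## §3 The one-sided comparison with the fine-path distance `msDistΩ` -/

section Comparison
variable {L M₁ R k : ℕ} {Ω : ℕ → Set (Pt d)} {s : ℕ → ℝ}

/-- The straight fine path `a, a + e_μ, …, a + n·e_μ`: the list of its `n` successive points after `a`. [folklore] -/
def straightPath (a : Pt d) (μ : Fin d) : ℕ → List (Pt d)
  | 0 => []
  | n + 1 => (a + e μ) :: straightPath (a + e μ) μ n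

/-- The straight path is a unit-step path ending at `a + n·e_μ`. [folklore] -/
theorem straightPath_isPath (a : Pt d) (μ : Fin d) : ∀ n : ℕ,
    IsPath a (straightPath a μ n) ∧ pathEnd a (straightPath a μ n) = a + (n : ℤ) • e μ
  | 0 => ⟨trivial, by simp [straightPath]⟩
  | n + 1 => by
    obtain ⟨hp, he⟩ := straightPath_isPath (a + e μ) μ n
    refine ⟨⟨⟨μ, Or.inl rfl⟩, hp⟩, ?_⟩
    rw [straightPath, pathEnd_cons, he, Nat.cast_succ, add_smul, one_smul]
    abel

/-- COST OF THE STRAIGHT PATH under a per-bond bound along it: if every point `a + t·e_μ`, `t ≤ n`, has weight-relevant bound `w ≤ C` on the bonds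
`{a + t e_μ, a + (t+1) e_μ}`, the straight path costs at most `n·C`. [folklore] -/
theorem pathCost_straightPath_le {w : Pt d → Pt d → ℝ} {C : ℝ} (μ : Fin d) :
    ∀ (n : ℕ) (a : Pt d), (∀ t : ℕ, t < n → w (a + (t : ℤ) • e μ) (a + ((t : ℤ) + 1) • e μ) ≤ C) →
      pathCost w a (straightPath a μ n) ≤ n * C
  | 0, a, _ => by simp [straightPath]
  | n + 1, a, h => by
    rw [straightPath, pathCost_cons, Nat.cast_succ, add_mul, one_mul, add_comm ((n : ℝ) * C)]
    refine add_le_add ?_ (pathCost_straightPath_le μ n (a + e μ) fun t ht => ?_)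
    · have := h 0 (Nat.succ_pos n)
      simpa using this
    · have := h (t + 1) (by omega)
      have e1 : a + e μ + (t : ℤ) • e μ = a + ((t + 1 : ℕ) : ℤ) • e μ := by rw [Nat.cast_succ, add_smul, one_smul]; abel
      have e2 : a + e μ + ((t : ℤ) + 1) • e μ = a + (((t + 1 : ℕ) : ℤ) + 1) • e μ := by
        simp only [Nat.cast_succ, add_smul, one_smul]; abel
      rw [e1, e2]; exact this

/-- Inside the `L^j`-block of a level-`j` lattice point: `a + t·e_μ`, `t < L^j`, has the same `L^j`-cube index as `a` (`L ≥ 1`). [folklore] -/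
theorem cubeIdx_add_smul_e_eq {L j : ℕ} (hL : 0 < L) {a : Pt d} (ha : IsLevel L j a) (μ : Fin d) {t : ℕ} (ht : t < L ^ j) :
    cubeIdx (L ^ j) (a + (t : ℤ) • e μ) = cubeIdx (L ^ j) a := by
  have hLj : (0 : ℤ) < (L : ℤ) ^ j := by exact_mod_cast pow_pos hL j
  funext i
  obtain ⟨q, hq⟩ := ha i
  simp only [cubeIdx, Pi.add_apply, Pi.smul_apply, smul_eq_mul]
  by_cases hi : i = μ
  · subst hi
    simp only [e, Pi.single_eq_same, mul_one]
    push_cast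
    rw [hq, Int.add_comm, Int.add_mul_ediv_left _ _ hLj.ne', Int.mul_ediv_cancel_left _ hLj.ne']
    rw [Int.ediv_eq_zero_of_lt (by positivity) (by exact_mod_cast ht), zero_add]
  · simp [e, Pi.single_eq_of_ne hi]

/-- Every point of the `L^j`-block of a level-`j` lattice point of index `≥ j` (`j ≥ 1`) has index `≥ j` (`Ω_j` is a union of `L^j`-blocks). [folklore] -/
theorem le_ptIndex_of_block (hΩ : BigDomainSeq L M₁ R k Ω) (hL : 0 < L) {j : ℕ} {a : Pt d} (ha : IsLevel L j a) (hja : j ≤ ptIndex k Ω a)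
    (hj : 0 < j) (μ : Fin d) {t : ℕ} (ht : t < L ^ j) : j ≤ ptIndex k Ω (a + (t : ℤ) • e μ) := by
  have hamem : a ∈ Ω j := mem_of_ptIndex_pos hΩ (lt_of_lt_of_le hj hja) hja
  have hblk : a + (t : ℤ) • e μ ∈ Ω j := (hΩ.blocks_le le_rfl _ _ (cubeIdx_add_smul_e_eq hL ha μ ht)).mpr hamem
  exact le_ptIndex_of_mem (hΩ.le_of_mem hblk) hblk

/-- **ONE ADMISSIBLE BOND COSTS AT MOST `L^j·(s j)⁻¹` IN `d_Ω`** for positive NON-DECREASING scales: the straight fine path along the bond has `L^j`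
unit steps, each starting (and ending) at a point of index `≥ j`, hence of weight `≤ (s j)⁻¹`. [folklore] -/
theorem msDistΩ_le_of_admAdj (hΩ : BigDomainSeq L M₁ R k Ω) (hL : 0 < L) (hs : ∀ j, 0 < s j) (hmono : Monotone s) {a b : Pt d}
    (h : (admGraph L k Ω).Adj a b) : msDistΩ s k Ω a b ≤ (L : ℝ) ^ (min (ptIndex k Ω a) (ptIndex k Ω b)) * (s (min (ptIndex k Ω a) (ptIndex k Ω b)))⁻¹ := by
  -- reduce to the orientation `b = a + L^j e_μ` with `a` the level point (the distance is symmetric)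
  suffices key : ∀ a b : Pt d, ∀ j μ, min (ptIndex k Ω a) (ptIndex k Ω b) = j → IsLevel L j a → b = a + ((L : ℤ) ^ j) • e μ →
      msDistΩ s k Ω a b ≤ (L : ℝ) ^ j * (s j)⁻¹ by
    obtain ⟨_, j, μ, hj, hor⟩ := admGraph_adj_iff.mp h
    rw [hj]
    rcases hor with ⟨ha, hb⟩ | ⟨hb, ha⟩
    · exact key a b j μ hj ha hb
    · rw [msDistΩ_comm s k Ω hs]
      exact key b a j μ (by rw [min_comm]; exact hj) hb ha
  intro a b j μ hj ha hb
  -- the straight path and its cost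
  obtain ⟨hp, he⟩ := straightPath_isPath a μ (L ^ j)
  have hend : pathEnd a (straightPath a μ (L ^ j)) = b := by rw [he, hb]; norm_cast
  have hw : ∀ t : ℕ, t < L ^ j → layerWeight s k Ω (a + (t : ℤ) • e μ) (a + ((t : ℤ) + 1) • e μ) ≤ (s j)⁻¹ := by
    intro t ht
    -- both endpoints of the `t`-th unit step have index `≥ j`
    have hι1 : j ≤ ptIndex k Ω (a + (t : ℤ) • e μ) := by
      rcases Nat.eq_zero_or_pos j with h0 | hj0
      · rw [h0]; exact Nat.zero_le _
      · exact le_ptIndex_of_block hΩ hL ha (by rw [← hj]; exact min_le_left _ _) hj0 μ ht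
    have hι2 : j ≤ ptIndex k Ω (a + ((t : ℤ) + 1) • e μ) := by
      rcases Nat.eq_zero_or_pos j with h0 | hj0
      · rw [h0]; exact Nat.zero_le _
      · rcases Nat.lt_or_ge (t + 1) (L ^ j) with hlt | hge
        · have := le_ptIndex_of_block hΩ hL ha (by rw [← hj]; exact min_le_left _ _) hj0 μ hlt
          simpa [Nat.cast_succ] using this
        · -- the last step ends at `b` itself, of index `≥ j`
          have ht1 : t + 1 = L ^ j := le_antisymm (by omega) hge
          have e1 : a + ((t : ℤ) + 1) • e μ = b := by
            rw [hb]
            have : ((t : ℤ) + 1) = ((L : ℤ) ^ j) := by exact_mod_cast ht1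
            rw [this]
          rw [e1, ← hj]; exact min_le_right _ _
    unfold layerWeight
    have h1 : (s (ptIndex k Ω (a + (t : ℤ) • e μ)))⁻¹ ≤ (s j)⁻¹ := inv_anti₀ (hs j) (hmono hι1)
    have h2 : (s (ptIndex k Ω (a + ((t : ℤ) + 1) • e μ)))⁻¹ ≤ (s j)⁻¹ := inv_anti₀ (hs j) (hmono hι2)
    linarith
  calc msDistΩ s k Ω a b ≤ pathCost (layerWeight s k Ω) a (straightPath a μ (L ^ j)) :=
        msDist_le_pathCost (layerWeight_nonneg s k Ω hs) hp hend
    _ ≤ (L ^ j : ℕ) * (s j)⁻¹ := pathCost_straightPath_le μ (L ^ j) a hw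
    _ = (L : ℝ) ^ j * (s j)⁻¹ := by push_cast; ring

/-- **THE ONE-SIDED COMPARISON** for GEOMETRIC scales `s i = c·L^i` (`c > 0`, `1 ≤ L`): every admissible bond costs at most `c⁻¹` in `d_Ω`, so along
any admissible walk `d_Ω(x, x′) ≤ c⁻¹ · length` (triangle inequality of `msDistΩ`). [folklore] -/
theorem msDistΩ_le_walk_length (hΩ : BigDomainSeq L M₁ R k Ω) {c : ℝ} (hc : 0 < c) (hL : 1 ≤ L) (hsc : ∀ i, s i = c * (L : ℝ) ^ i) :
    ∀ {x x' : Pt d} (p : (admGraph L k Ω).Walk x x'), msDistΩ s k Ω x x' ≤ c⁻¹ * p.length := by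
  have hL0 : 0 < L := lt_of_lt_of_le Nat.zero_lt_one hL
  have hLr : (1 : ℝ) ≤ L := by exact_mod_cast hL
  have hs : ∀ i, 0 < s i := fun i => by rw [hsc i]; positivity
  have hmono : Monotone s := fun a b hab => by
    rw [hsc, hsc]; exact mul_le_mul_of_nonneg_left (pow_le_pow_right₀ hLr hab) hc.le
  have hedge : ∀ {a b : Pt d}, (admGraph L k Ω).Adj a b → msDistΩ s k Ω a b ≤ c⁻¹ := by
    intro a b h
    refine (msDistΩ_le_of_admAdj hΩ hL0 hs hmono h).trans (le_of_eq ?_)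
    rw [hsc]
    have : (L : ℝ) ^ min (ptIndex k Ω a) (ptIndex k Ω b) ≠ 0 := pow_ne_zero _ (by positivity)
    field_simp
  intro x x' p
  induction p with
  | nil => simp [msDistΩ, msDist_self (layerWeight_nonneg s k Ω hs)]
  | @cons u v w huv p ih =>
    rw [SimpleGraph.Walk.length_cons, Nat.cast_succ, mul_add, mul_one]
    calc msDistΩ s k Ω u w ≤ msDistΩ s k Ω u v + msDistΩ s k Ω v w := msDistΩ_triangle s k Ω hs u v w
      _ ≤ c⁻¹ + c⁻¹ * p.length := add_le_add (hedge huv) ih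
      _ = c⁻¹ * p.length + c⁻¹ := add_comm _ _

/-- Hence, on REACHABLE pairs, `d_Ω(x, x′) ≤ c⁻¹ · dist_G(x, x′)` — the fine-path reading never exceeds the admissible-bond reading (scaled); the
reverse inequality is not claimed. [folklore] -/
theorem msDistΩ_le_dist_admGraph (hΩ : BigDomainSeq L M₁ R k Ω) {c : ℝ} (hc : 0 < c) (hL : 1 ≤ L) (hsc : ∀ i, s i = c * (L : ℝ) ^ i)
    {x x' : Pt d} (hr : (admGraph L k Ω).Reachable x x') : msDistΩ s k Ω x x' ≤ c⁻¹ * (admGraph L k Ω).dist x x' := by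
  obtain ⟨p, hp⟩ := hr.exists_walk_length_eq_dist
  rw [← hp]
  exact msDistΩ_le_walk_length hΩ hc hL hsc p

end Comparison

/-! ## §4 The assembled (3.42) ⇒ (3.47) junction AT THE CELL'S DISTANCE `d_Ω` (separation discharged) -/

section Assembly
variable {L M₁ R k : ℕ} {Ω : ℕ → Set (Pt d)} {s : ℕ → ℝ} {E G : Type*} [SeminormedAddCommGroup E] [SeminormedAddCommGroup G]
  {f : Pt d → E} {P : Pt d → G}

/-- **`SmallFieldDomainsMetricSchur.WSupLePrint.of_localDecay` AT `dist = d_Ω`, ITS (2.60)-SHAPE SEPARATION HYPOTHESIS DISCHARGED** by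
`SmallFieldDomainsMetricSep.indexSep_msDistΩ_ptIndex` (`D = R·M₁/(2c)`, `R·M₁ > 0`): for geometric scales `s i = c·L^i`, a finite `S ⊆ Ω₀`, a
(3.42)-shape blockwise local-decay majorant in `e^{−δ₀ d_Ω}` and a (2.61)-shape row sum of `e^{−δ′ d_Ω}` at the reduced rate
`δ′ = δ₀ − |γ|·log L·(2c)/(R·M₁)`, one gets `WSupLePrint s Ω γ f B → WSupLePrint s Ω (σ+γ) P (B₀·L^{|γ|}·C₁·B)`.  What remains a HYPOTHESIS is exactly
[B6] (2.61) (the row sum) and the local bound (3.42) itself — the two printed estimates; everything geometric is proved. [folklore] -/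
theorem WSupLePrint.of_localDecay_msDistΩ (hΩ : BigDomainSeq L M₁ R k Ω) {c : ℝ} (hc : 0 < c) (hL : 1 ≤ L) (hsc : ∀ i, s i = c * (L : ℝ) ^ i)
    (hRM : 0 < (R : ℝ) * M₁) (S : Finset (Pt d)) (hS : ∀ x' ∈ S, x' ∈ Ω 0) {B₀ δ₀ : ℝ} (hB₀ : 0 ≤ B₀) {σ γ : ℤ}
    (hP : ∀ x, x ∈ Ω 0 → ∀ u : Pt d → ℝ,
      (∀ x' ∈ S, ∀ x'', cubeIdx (L ^ ptIndex k Ω x') x'' = cubeIdx (L ^ ptIndex k Ω x') x' → ‖f x''‖ ≤ u x') →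
        ‖P x‖ ≤ ∑ x' ∈ S, B₀ * s (ptIndex k Ω x) ^ σ * Real.exp (-(δ₀ * msDistΩ s k Ω x x')) * u x')
    {C₁ : ℝ} (hrow : ∀ x, x ∈ Ω 0 →
      ∑ x' ∈ S, Real.exp (-((δ₀ - γ.natAbs * Real.log L / ((R : ℝ) * M₁ / (2 * c))) * msDistΩ s k Ω x x')) ≤ C₁)
    {B : ℝ} (hB : 0 ≤ B) (hf : WSupLePrint s Ω γ f B) :
    WSupLePrint s Ω (σ + γ) P (B₀ * (L : ℝ) ^ γ.natAbs * C₁ * B) := by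
  have hLr : (1 : ℝ) ≤ L := by exact_mod_cast hL
  have hs : ∀ i, 0 < s i := fun i => by rw [hsc i]; positivity
  have hD : 0 < (R : ℝ) * M₁ / (2 * c) := by positivity
  exact WSupLePrint.of_localDecay hΩ hc hLr hsc S hS (fun x x' => msDistΩ_nonneg s k Ω hs x x') hD
    (fun x hx x' hx' => indexSep_msDistΩ_ptIndex hΩ hc hL hsc hx (hS x' hx')) hB₀ hP hrow hB hf

end Assembly

end Summit.QuantumFields.BalabanUV.T4Continuum.SmallFieldDomains

end
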